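import Literature.NumberTheory.Irrationality.Zudilin2014.FirstTale

/-!
# Zudilin 2014, first tale: the partial-fraction identity (P1) and the `S₄` scaling law

Topic `Literature/NumberTheory/Irrationality/Zudilin2014` [Zudilin2014ZetaTwo, Section 3].  PROVED here:

* `pf_range` / `pf_den` — the classical decomposition
  `n!/((t+lo)(t+lo+1)⋯(t+lo+n)) = Σ_{j=0}^{n} (−1)^j binom(n,j)/(t+lo+j)` (the residues `ε_k` of Zudilin's `R₂`,
  proof of Lemma 5);
* `R_eq_polyP_add_polar` — **eq. (P1)**: off the poles, `R(t) = P(t) + Σ_{k=a₄*}^{b₄−1} C_k/(t+k)` with the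
  typed `P = polyP`, `C_k = coefC` of `FirstTale` (so the typed closed forms ARE the printed partial fractions);
* `polar_unique` — uniqueness of a decomposition `Q(t) + Σ_k c_k/(t+k)` vanishing at all but finitely many `t`;
* the **scaling law** [cite: Zudilin2014ZetaTwo, Proposition 1 (last sentence) and proof of Lemma 7]: for every
  permutation `σ` of `a₁,…,a₄`, `X(σa,b)·Π(a,b) = X(a,b)·Π(σa,b)` for `X = C_k` (`coefC_perm`), `P` (`polyP_perm`),
  `q` (`formQ_perm`), `A_ℓ` (`coefA_perm`), `p` (`formP_perm`) — the algebraic content of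
  "`r(a,b)/Π(a,b)` is invariant", which Lemma 7 turns into the `p`-adic saving `ord_p Π(a,b)/Π(σa,b)`.

Cell pub-zeta5 (HONEST FRAMING: systematic search; no irrationality claim unless certified).
-/

noncomputable section

open Polynomial Finset

namespace Literature.NumberTheory.Irrationality.Zudilin2014

/-! ### Partial fractions of `n!/((t+lo)⋯(t+lo+n))` -/

/-- Iterated differences of `k ↦ 1/(u+k)`: `Δⁿ[1/(u+·)](y) = (−1)ⁿ n!/∏_{j=0}^{n} (u+y+j)`. [cite: Zudilin2014ZetaTwo, proof of Lemma 5 (partial fractions of R₂)] -/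
theorem fwdDiff_iter_inv (u : ℚ) : ∀ (n y : ℕ), (∀ j : ℕ, j ≤ n → u + y + j ≠ 0) →
    (fwdDiff (1 : ℕ))^[n] (fun k : ℕ => 1 / (u + k)) y = (-1) ^ n * n.factorial / ∏ j ∈ range (n + 1), (u + y + j) := by
  intro n
  induction n with
  | zero => intro y _; simp
  | succ n ih =>
    intro y hy
    rw [Function.iterate_succ_apply', fwdDiff, ih y fun j hj => hy j (Nat.le_succ_of_le hj),
      ih (y + 1) fun j hj => by
        have := hy (j + 1) (Nat.succ_le_succ hj); push_cast at this ⊢; ring_nf at this ⊢; exact this]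
    set A := ∏ j ∈ range (n + 1), (u + y + j) with hA
    set B := ∏ j ∈ range (n + 1), (u + ((y + 1 : ℕ) : ℚ) + j) with hB
    have hAne : A ≠ 0 := prod_ne_zero_iff.2 fun j hj => hy j (by have := mem_range.1 hj; omega)
    have hBne : B ≠ 0 := prod_ne_zero_iff.2 fun j hj => by
      have := hy (j + 1) (by have := mem_range.1 hj; omega); push_cast at this ⊢; ring_nf at this ⊢; exact this
    have hu : u + y ≠ 0 := by simpa using hy 0 (Nat.zero_le _)
    have hw : u + y + (n + 1 : ℕ) ≠ 0 := hy (n + 1) le_rfl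
    have hP1 : ∏ j ∈ range (n + 2), (u + y + j) = A * (u + y + (n + 1 : ℕ)) := prod_range_succ _ _
    have hP2 : ∏ j ∈ range (n + 2), (u + y + j) = (u + y) * B := by
      rw [hB, prod_range_succ']; push_cast; ring_nf
    have hBeq : B = A * (u + y + (n + 1 : ℕ)) / (u + y) := by
      rw [eq_div_iff hu, mul_comm B, ← hP2, hP1]
    rw [hP1, hBeq]
    field_simp
    push_cast [Nat.factorial_succ]
    ring

/-- `n!/∏_{j=0}^{n} (u+j) = Σ_{j=0}^{n} (−1)^j binom(n,j)/(u+j)` whenever no factor vanishes. [cite: Zudilin2014ZetaTwo, proof of Lemma 5 (partial fractions of R₂)] -/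
theorem pf_range (n : ℕ) (u : ℚ) (hu : ∀ j : ℕ, j ≤ n → u + j ≠ 0) :
    (n.factorial : ℚ) / ∏ j ∈ range (n + 1), (u + j)
      = ∑ j ∈ range (n + 1), (-1) ^ j * (n.choose j : ℚ) / (u + j) := by
  have hD := fwdDiff_iter_inv u n 0 (by simpa using hu)
  rw [fwdDiff_iter_eq_sum_shift] at hD
  simp only [Nat.cast_zero, add_zero, smul_eq_mul, zsmul_eq_mul, Int.cast_mul, Int.cast_pow,
    Int.cast_neg, Int.cast_one, Int.cast_natCast, zero_add, mul_one] at hD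
  have hflip : ∀ j ∈ range (n + 1), (-1 : ℚ) ^ (n - j) = (-1) ^ n * (-1) ^ j := fun j hj => by
    have hj' : j ≤ n := Nat.lt_succ_iff.1 (mem_range.1 hj)
    rw [← pow_add]
    conv_rhs => rw [← Nat.sub_add_cancel hj', pow_add, pow_add, mul_assoc, ← pow_add, ← two_mul, pow_mul]
    norm_num
  have hsum : ∑ j ∈ range (n + 1), (-1 : ℚ) ^ (n - j) * (n.choose j : ℚ) * (1 / (u + j))
      = (-1) ^ n * ∑ j ∈ range (n + 1), (-1) ^ j * (n.choose j : ℚ) / (u + j) := by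
    rw [mul_sum]
    refine sum_congr rfl fun j hj => ?_
    rw [hflip j hj]; ring
  rw [hsum] at hD
  have h1 : ((-1 : ℚ) ^ n) * ((-1) ^ n) = 1 := by rw [← pow_add, ← two_mul, pow_mul]; norm_num
  calc (n.factorial : ℚ) / ∏ j ∈ range (n + 1), (u + j)
      = (-1 : ℚ) ^ n * ((-1) ^ n * n.factorial / ∏ j ∈ range (n + 1), (u + j)) := by
        rw [← mul_div_assoc, ← mul_assoc, h1, one_mul]
    _ = (-1 : ℚ) ^ n * ((-1) ^ n * ∑ j ∈ range (n + 1), (-1) ^ j * (n.choose j : ℚ) / (u + j)) := by rw [hD]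
    _ = _ := by rw [← mul_assoc, h1, one_mul]

/-- **Partial fractions of Zudilin's `R₂`** (proof of Lemma 5): for `t` off the integers `−k`, `lo ≤ k ≤ lo+n`,
`n!/∏_{k=lo}^{lo+n} (t+k) = Σ_{k=lo}^{lo+n} (−1)^{k−lo} binom(n,k−lo)/(t+k)`. [cite: Zudilin2014ZetaTwo, proof of Lemma 5 (partial fractions of R₂)] -/
theorem pf_den (n : ℕ) (lo : ℤ) (t : ℚ) (ht : ∀ k ∈ Ico lo (lo + n + 1), t + k ≠ 0) :
    (n.factorial : ℚ) / ∏ k ∈ Ico lo (lo + n + 1), (t + k)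
      = ∑ k ∈ Ico lo (lo + n + 1), (-1) ^ (k - lo).toNat * (n.choose (k - lo).toNat : ℚ) / (t + k) := by
  have himage : Ico lo (lo + n + 1) = (range (n + 1)).image fun j : ℕ => lo + j := by
    ext k
    simp only [mem_Ico, mem_image, mem_range]
    constructor
    · rintro ⟨h1, h2⟩
      refine ⟨(k - lo).toNat, by omega, by omega⟩
    · rintro ⟨j, hj, rfl⟩; omega
  have hinj : Set.InjOn (fun j : ℕ => lo + (j : ℤ)) (range (n + 1) : Finset ℕ) := by
    intro x _ y _ h; simpa using h
  rw [himage, prod_image hinj, sum_image hinj]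
  have ht' : ∀ j : ℕ, j ≤ n → (t + (lo : ℚ)) + j ≠ 0 := fun j hj => by
    have := ht (lo + j) (by simp [mem_Ico]; omega)
    push_cast at this; rw [← add_assoc] at this; exact this
  have e := pf_range n (t + lo) ht'
  simp only [Int.cast_add, Int.cast_natCast, ← add_assoc] at e ⊢
  rw [e]
  refine sum_congr rfl fun j _ => ?_
  simp

/-! ### Eq. (P1): `R = P + Σ C_k/(t+k)` -/

/-- `(X + k) · dq F k = F − F(−k)`. [cite: Zudilin2014ZetaTwo, Section 3, eq. (P1)] -/
theorem X_add_mul_dq (F : ℚ[X]) (k : ℤ) : (X + C (k : ℚ)) * dq F k = F - C (F.eval (-(k : ℚ))) := by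
  have e : (X + C (k : ℚ) : ℚ[X]) = X - C (-(k : ℚ)) := by rw [map_neg, sub_neg_eq_add]
  unfold dq
  rw [e]
  exact mul_divByMonic_eq_iff_isRoot.2 (by simp [IsRoot])

/-- Pointwise form: `F(t) = (t+k)·(dq F k)(t) + F(−k)`. [cite: Zudilin2014ZetaTwo, Section 3, eq. (P1)] -/
theorem eval_eq_dq (F : ℚ[X]) (k : ℤ) (t : ℚ) :
    F.eval t = (t + k) * (dq F k).eval t + F.eval (-(k : ℚ)) := by
  have e := congrArg (fun G : ℚ[X] => G.eval t) (X_add_mul_dq F k)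
  simp only [eval_mul, eval_add, eval_X, eval_C, eval_sub] at e
  linear_combination -e

/-- `num = numFac · R₁`. [cite: Zudilin2014ZetaTwo, proof of Lemma 5 (R = R₁R₂)] -/
theorem num_eq_numFac_mul_R1 (a b : Fin 4 → ℤ) : num a b = C (numFac a b) * R1 a b := by
  unfold R1; rw [← mul_assoc, ← C_mul, mul_inv_cancel₀ (numFac_ne_zero a b), C_1, one_mul]

/-- For admissible parameters `a₄ ≤ b₄ − 1`, so the pole range is `Ico a₄ (a₄ + N + 1)`, `N = b₄ − a₄ − 1`. [cite: Zudilin2014ZetaTwo, Section 3, eq. (cond1)] -/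
theorem Ico_a3_eq {a b : Fin 4 → ℤ} (h : Admissible a b) :
    Ico (a 3) (b 3) = Ico (a 3) (a 3 + ((b 3 - a 3 - 1).toNat : ℕ) + 1) := by
  have := h.upper 3; congr 1; omega

/-- **Eq. (P1)** [cite: Zudilin2014ZetaTwo, Section 3, eq. (P1)–(P2)]: off the zeros of `den`,
`R(a,b;t) = P(t) + Σ_{k=a₄}^{b₄−1} C_k/(t+k)` with `P = polyP`, `C_k = coefC`. -/
theorem R_eq_polyP_add_polar_full {a b : Fin 4 → ℤ} (h : Admissible a b) {t : ℚ}
    (ht : ∀ k ∈ Ico (a 3) (b 3), t + k ≠ 0) :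
    R a b t = (polyP a b).eval t + ∑ k ∈ Ico (a 3) (b 3), coefC a b k / (t + k) := by
  have hden : (den a b).eval t = ∏ k ∈ Ico (a 3) (b 3), (t + k) := eval_block _ _ _
  have hpf := pf_den (b 3 - a 3 - 1).toNat (a 3) t (by rw [← Ico_a3_eq h]; exact ht)
  rw [← Ico_a3_eq h] at hpf
  -- R = R₁(t) · (N!/den(t))
  have hR : R a b t = (R1 a b).eval t * (((b 3 - a 3 - 1).toNat.factorial : ℚ) / ∏ k ∈ Ico (a 3) (b 3), (t + k)) := by
    unfold R Pi facZ
    rw [hden, num_eq_numFac_mul_R1, eval_mul, eval_C]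
    field_simp [numFac_ne_zero a b]
  rw [hR, hpf, mul_sum, polyP, eval_finsetSum, ← sum_add_distrib]
  refine sum_congr rfl fun k hk => ?_
  have hk0 : t + k ≠ 0 := ht k hk
  rw [eval_mul, eval_C, coefC, eps]
  have e := eval_eq_dq (R1 a b) k t
  field_simp
  rw [e]; ring

/-- For `k < a₄*` (below the largest `a_j`) the numerator vanishes at `−k`: `R₁(−k) = 0`, hence `C_k = 0`. [cite: Zudilin2014ZetaTwo, Section 3 (zeroes of R)] -/
theorem R1_eval_neg_eq_zero {a b : Fin 4 → ℤ} (h : Admissible a b) {k : ℤ} (hk : a 3 ≤ k) (hk' : k < amax a) :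
    (R1 a b).eval (-(k : ℚ)) = 0 := by
  unfold R1 num
  rw [eval_mul]
  refine mul_eq_zero_of_right _ ?_
  have hz : ∀ j : Fin 4, j ≠ 3 → k < a j → (block (b j) (a j)).eval (-(k : ℚ)) = 0 := fun j hj hkj =>
    (eval_block_eq_zero_iff _ _ _).2 ⟨k, mem_Ico.2 ⟨(h.lower j hj 3).trans hk, hkj⟩, rfl⟩
  simp only [eval_mul]
  unfold amax at hk'
  rcases lt_max_iff.1 hk' with h01 | h23
  · rcases lt_max_iff.1 h01 with h0 | h1
    · rw [hz 0 (by decide) h0]; ring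
    · rw [hz 1 (by decide) h1]; ring
  · rcases lt_max_iff.1 h23 with h2 | h3
    · rw [hz 2 (by decide) h2]; ring
    · exact absurd h3 (not_lt.2 hk)

/-- `C_k = 0` for `a₄ ≤ k < a₄*`. [cite: Zudilin2014ZetaTwo, proof of Lemma 5] -/
theorem coefC_eq_zero_of_lt {a b : Fin 4 → ℤ} (h : Admissible a b) {k : ℤ} (hk : a 3 ≤ k) (hk' : k < amax a) :
    coefC a b k = 0 := by
  rw [coefC, R1_eval_neg_eq_zero h hk hk', mul_zero]

/-- **Eq. (P1) on the printed range** `a₄* ≤ k ≤ b₄ − 1`: `R(t) = P(t) + Σ_{k=a₄*}^{b₄−1} C_k/(t+k)`. [cite: Zudilin2014ZetaTwo, Section 3, eq. (P1)] -/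
theorem R_eq_polyP_add_polar {a b : Fin 4 → ℤ} (h : Admissible a b) {t : ℚ}
    (ht : ∀ k ∈ Ico (a 3) (b 3), t + k ≠ 0) :
    R a b t = (polyP a b).eval t + ∑ k ∈ Ico (amax a) (b 3), coefC a b k / (t + k) := by
  rw [R_eq_polyP_add_polar_full h ht]
  congr 1
  have hsub : Ico (amax a) (b 3) ⊆ Ico (a 3) (b 3) := Ico_subset_Ico (le_amax a 3) le_rfl
  symm
  refine sum_subset hsub fun k hk hk' => ?_
  have hk1 := mem_Ico.1 hk
  have hlt : k < amax a := by
    by_contra hc; exact hk' (mem_Ico.2 ⟨not_lt.1 hc, hk1.2⟩)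
  rw [coefC_eq_zero_of_lt h hk1.1 hlt, zero_div]

/-! ### Uniqueness of `Q(t) + Σ c_k/(t+k)` -/

/-- **Uniqueness of partial fractions.** If `Q(t) + Σ_{k∈S} c_k/(t+k) = 0` for all rational `t` outside a finite
set, then `Q = 0` and all `c_k = 0`. [cite: Zudilin2014ZetaTwo, Section 3, eq. (P1) (uniqueness of the partial-fraction decomposition)] -/
theorem polar_unique (S : Finset ℤ) (E : Finset ℚ) (Q : ℚ[X]) (c : ℤ → ℚ)
    (hyp : ∀ t : ℚ, t ∉ E → (∀ k ∈ S, t + k ≠ 0) → Q.eval t + ∑ k ∈ S, c k / (t + k) = 0) :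
    Q = 0 ∧ ∀ k ∈ S, c k = 0 := by
  classical
  set DS : ℚ[X] := ∏ k ∈ S, (X + C (k : ℚ)) with hDS
  set Dh : ℤ → ℚ[X] := fun k => ∏ k' ∈ S.erase k, (X + C (k' : ℚ)) with hDh
  set G : ℚ[X] := Q * DS + ∑ k ∈ S, C (c k) * Dh k with hG
  have hDS_eval : ∀ t : ℚ, DS.eval t = ∏ k ∈ S, (t + k) := fun t => by
    simp [hDS, eval_prod]
  have hDh_eval : ∀ (k : ℤ) (t : ℚ), (Dh k).eval t = ∏ k' ∈ S.erase k, (t + k') := fun k t => by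
    simp [hDh, eval_prod]
  -- G vanishes off E ∪ {−k}
  have hGroot : ∀ t : ℚ, t ∉ E → (∀ k ∈ S, t + k ≠ 0) → G.IsRoot t := by
    intro t htE htS
    have hmul : G.eval t = DS.eval t * (Q.eval t + ∑ k ∈ S, c k / (t + k)) := by
      rw [hG, eval_add, eval_mul, eval_finsetSum, mul_add, mul_comm, mul_sum]
      congr 1
      refine sum_congr rfl fun k hk => ?_
      rw [eval_mul, eval_C, hDh_eval, hDS_eval, ← mul_prod_erase S (fun k' => t + (k' : ℚ)) hk]
      field_simp [htS k hk]
    rw [IsRoot, hmul, hyp t htE htS, mul_zero]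
  have hGzero : G = 0 := by
    apply eq_zero_of_infinite_isRoot
    have hfin : (↑E ∪ ((S.image fun k : ℤ => -(k : ℚ)) : Set ℚ)).Finite :=
      (E.finite_toSet).union (Finset.finite_toSet _)
    refine (hfin.infinite_compl).mono fun t ht => hGroot t ?_ ?_
    · exact fun h => ht (Or.inl h)
    · intro k hk h0
      exact ht (Or.inr (by simp only [coe_image, Set.mem_image, mem_coe]; exact ⟨k, hk, by linarith⟩))
  -- coefficients vanish
  have hc : ∀ k ∈ S, c k = 0 := by
    intro k₀ hk₀
    have e := congrArg (fun F : ℚ[X] => F.eval (-(k₀ : ℚ))) hGzero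
    simp only [hG, eval_add, eval_mul, eval_finsetSum, eval_C, eval_zero] at e
    have hDS0 : DS.eval (-(k₀ : ℚ)) = 0 := by
      rw [hDS_eval]; exact prod_eq_zero hk₀ (by ring)
    rw [hDS0, mul_zero, zero_add, ← add_sum_erase S _ hk₀] at e
    have hrest : ∑ k ∈ S.erase k₀, c k * (Dh k).eval (-(k₀ : ℚ)) = 0 := by
      refine sum_eq_zero fun k hk => ?_
      rw [hDh_eval, prod_eq_zero (mem_erase.2 ⟨(ne_of_mem_erase hk).symm, hk₀⟩) (by ring), mul_zero]
    rw [hrest, add_zero] at e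
    have hne : (Dh k₀).eval (-(k₀ : ℚ)) ≠ 0 := by
      rw [hDh_eval]
      refine prod_ne_zero_iff.2 fun k hk h0 => ne_of_mem_erase hk ?_
      have : ((k : ℤ) : ℚ) = k₀ := by linarith
      exact_mod_cast this
    exact (mul_eq_zero.1 e).resolve_right hne
  refine ⟨?_, hc⟩
  have hsum : ∑ k ∈ S, C (c k) * Dh k = 0 := sum_eq_zero fun k hk => by rw [hc k hk, C_0, zero_mul]
  rw [hG, hsum, add_zero] at hGzero
  exact (mul_eq_zero.1 hGzero).resolve_right
    (prod_ne_zero_iff.2 fun k _ => (monic_X_add_C (k : ℚ)).ne_zero)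

/-! ### The scaling law under permutations of `a` -/

section Scaling

variable {a b : Fin 4 → ℤ} (h : Admissible a b) (σ : Equiv.Perm (Fin 4))
include h

/-- **Scaling of `C_k` and `P`**: `C_k(σa,b)·Π(a,b) = C_k(a,b)·Π(σa,b)` for `a₄* ≤ k < b₄`, and
`P(σa,b)·Π(a,b) = P(a,b)·Π(σa,b)`. [cite: Zudilin2014ZetaTwo, Proposition 1 and proof of Lemma 7] -/
theorem polyP_coefC_perm :
    C (Pi a b) * polyP (a ∘ σ) b = C (Pi (a ∘ σ) b) * polyP a b ∧
      ∀ k ∈ Ico (amax a) (b 3), coefC (a ∘ σ) b k * Pi a b = coefC a b k * Pi (a ∘ σ) b := by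
  have hσ := h.perm σ
  -- exclusion set: all `−k`, `k` in either pole block
  set E : Finset ℚ := (Ico (a 3) (b 3) ∪ Ico ((a ∘ σ) 3) (b 3)).image fun k : ℤ => -(k : ℚ) with hE
  have key := polar_unique (Ico (amax a) (b 3)) E
    (C (Pi a b) * polyP (a ∘ σ) b - C (Pi (a ∘ σ) b) * polyP a b)
    (fun k => coefC (a ∘ σ) b k * Pi a b - coefC a b k * Pi (a ∘ σ) b) ?_
  · refine ⟨sub_eq_zero.1 key.1, fun k hk => sub_eq_zero.1 (key.2 k hk)⟩
  intro t htE _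
  have hoff : ∀ k ∈ Ico (a 3) (b 3) ∪ Ico ((a ∘ σ) 3) (b 3), t + k ≠ 0 := by
    intro k hk h0
    exact htE (mem_image.2 ⟨k, hk, by linarith⟩)
  have ht1 : ∀ k ∈ Ico (a 3) (b 3), t + k ≠ 0 := fun k hk => hoff k (mem_union_left _ hk)
  have ht2 : ∀ k ∈ Ico ((a ∘ σ) 3) (b 3), t + k ≠ 0 := fun k hk => hoff k (mem_union_right _ hk)
  have hd1 : (den a b).eval t ≠ 0 := eval_block_ne_zero fun k hk h0 => ht1 k hk (by rw [h0]; ring)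
  have hd2 : (den (a ∘ σ) b).eval t ≠ 0 := eval_block_ne_zero fun k hk h0 => ht2 k hk (by rw [h0]; ring)
  have e := R_perm_mul_Pi h σ hd1 hd2
  rw [R_eq_polyP_add_polar h ht1, R_eq_polyP_add_polar hσ ht2, amax_perm] at e
  simp only [eval_sub, eval_mul, eval_C]
  have : ∑ k ∈ Ico (amax a) (b 3), (coefC (a ∘ σ) b k * Pi a b - coefC a b k * Pi (a ∘ σ) b) / (t + k)
      = (∑ k ∈ Ico (amax a) (b 3), coefC (a ∘ σ) b k / (t + k)) * Pi a b
        - (∑ k ∈ Ico (amax a) (b 3), coefC a b k / (t + k)) * Pi (a ∘ σ) b := by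
    rw [sum_mul, sum_mul, ← sum_sub_distrib]
    refine sum_congr rfl fun k _ => ?_; ring
  rw [this]
  linear_combination e

/-- `P(σa,b)·Π(a,b) = P(a,b)·Π(σa,b)` (polynomial identity). [cite: Zudilin2014ZetaTwo, Proposition 1 and proof of Lemma 7] -/
theorem polyP_perm : C (Pi a b) * polyP (a ∘ σ) b = C (Pi (a ∘ σ) b) * polyP a b :=
  (polyP_coefC_perm h σ).1

/-- `C_k(σa,b)·Π(a,b) = C_k(a,b)·Π(σa,b)` for `a₄* ≤ k < b₄`. [cite: Zudilin2014ZetaTwo, Proposition 1 and proof of Lemma 7] -/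
theorem coefC_perm {k : ℤ} (hk : k ∈ Ico (amax a) (b 3)) :
    coefC (a ∘ σ) b k * Pi a b = coefC a b k * Pi (a ∘ σ) b :=
  (polyP_coefC_perm h σ).2 k hk

/-- **`q(σa,b)·Π(a,b) = q(a,b)·Π(σa,b)`** [cite: Zudilin2014ZetaTwo, Proposition 1 and proof of Lemma 7]. -/
theorem formQ_perm : formQ (a ∘ σ) b * Pi a b = formQ a b * Pi (a ∘ σ) b := by
  unfold formQ
  rw [dExp_perm, amax_perm, mul_assoc, mul_assoc, sum_mul, sum_mul]
  congr 1
  exact sum_congr rfl fun k hk => coefC_perm h σ hk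

/-- `A_ℓ(σa,b)·Π(a,b) = A_ℓ(a,b)·Π(σa,b)`. [cite: Zudilin2014ZetaTwo, Proposition 1 and proof of Lemma 7] -/
theorem coefA_perm (l : ℕ) : coefA (a ∘ σ) b l * Pi a b = coefA a b l * Pi (a ∘ σ) b := by
  unfold coefA
  rw [a2star_perm, sum_mul, sum_mul]
  refine sum_congr rfl fun i _ => ?_
  have e := congrArg (fun F : ℚ[X] => F.eval ((1 : ℚ) + i - a2star a)) (polyP_perm h σ)
  simp only [eval_mul, eval_C] at e
  linear_combination (-1) ^ (l - i) * (Nat.choose l i : ℚ) * e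

/-- **`p(σa,b)·Π(a,b) = p(a,b)·Π(σa,b)`** [cite: Zudilin2014ZetaTwo, Proposition 1 and proof of Lemma 7]. -/
theorem formP_perm : formP (a ∘ σ) b * Pi a b = formP a b * Pi (a ∘ σ) b := by
  unfold formP
  rw [dExp_perm, amax_perm, a2star_perm, mul_assoc, mul_assoc]
  congr 1
  rw [sub_mul, sub_mul, sum_mul, sum_mul, sum_mul, sum_mul]
  congr 1
  · refine sum_congr rfl fun k hk => ?_
    rw [mul_right_comm, coefC_perm h σ hk]; ring
  · refine sum_congr rfl fun l _ => ?_
    have e := coefA_perm h σ l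
    calc (-1) ^ l * coefA (a ∘ σ) b l / (l + 1) * Pi a b
        = (-1) ^ l * (coefA (a ∘ σ) b l * Pi a b) / (l + 1) := by ring
      _ = (-1) ^ l * (coefA a b l * Pi (a ∘ σ) b) / (l + 1) := by rw [e]
      _ = _ := by ring

end Scaling

end Literature.NumberTheory.Irrationality.Zudilin2014

end
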